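import Literature.ModelTheory.FiniteModelTheory.CohomologicalConsistencyLimits
import Literature.ModelTheory.FiniteModelTheory.ESODefinability
import Literature.ModelTheory.FiniteModelTheory.ESOVerifier
import HarnessLib

/-!
# `CSP(T) ∈ NP` for every finite template `T` (via Fagin's easy direction)

Topic `Literature/ModelTheory/FiniteModelTheory`; support file for the discharge of
`LichterPago2025_cohomologyFooled` (`CohomologicalConsistencyLimits.lean`), where "NP-complete
template" means `IsNPComplete (cspLanguage T)`.

For a finite relational template `T : RelTables ar m` the class `CSP(T)` of finite `ar`-structures
mapping homomorphically to `T` is defined by the existential second-order sentence "there are unary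
predicates `P₀, …, P_{m-1}` forming a partition of the universe such that every input tuple
`R_s(x̄)` is sent, colour by colour, into `T_s`" (Feder–Vardi: every `CSP(T)` is in monotone monadic
SNP).  With the tree's toolkit of uniformly first-order definable queries (`JQuery.IsDef`,
`ESODefinability.lean`) and the proved easy direction of Fagin's theorem (`eso_subset_NP_holds`,
`ESOVerifier.lean`) this gives **`cspLanguage_mem_NP : cspLanguage T ∈ NP`** for every template over
a non-degenerate vocabulary (some arity `≥ 1`, the size convention of `fagin_theorem`).

## References

* T. Feder, M. Y. Vardi, *The computational structure of monotone monadic SNP and constraint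
  satisfaction*, SIAM J. Comput. 28 (1998), §1 (every CSP(T) is in MMSNP ⊆ NP).
* [Libkin2004] L. Libkin, *Elements of Finite Model Theory*, Springer 2004, Thm. 9.6 (proof, first
  part, p. 170: `∃SO ⊆ NP`).
-/

namespace Literature.ModelTheory.FiniteModelTheory

open Literature.Computability.Cryptography Literature.Computability.Complexity

namespace CSPInNP

variable {ar : List ℕ} {m : ℕ}

/-- The witness vocabulary: `m` unary predicates `P_c`, "this element is mapped to `c`". [folklore] -/
abbrev cspWit (m : ℕ) : List ℕ := List.replicate m 1

/-- The witness symbol of colour `c`. [folklore] -/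
def wsym (c : Fin m) : Fin (cspWit m).length := ⟨c, by simp⟩

/-- The colour of a witness symbol. [folklore] -/
def colourOf (s : Fin (cspWit m).length) : Fin m := ⟨s, by simpa using s.2⟩

/-- `colourOf (wsym c) = c`. [folklore] -/
@[simp] theorem colourOf_wsym (c : Fin m) : colourOf (wsym c) = c := Fin.ext rfl

/-- The witness atom `P_c a` (all arguments of the unary symbol set to `a`). [folklore] -/
def Pc {n : ℕ} (W : RelTables (cspWit m) n) (c : Fin m) (a : Fin n) : Prop :=
  W (wsym c) (fun _ => a) = true

/-- **The first-order part of the `∃SO` sentence defining `CSP(T)`**: the `P_c` form a partition and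
every input tuple goes into the template relation. [cite: Libkin2004, Thm. 9.6 (proof, first part: guess and check)] -/
def cspQuery (T : RelTables ar m) : JQuery ar (cspWit m) Empty := fun n R W _ =>
  (∀ a : Fin n, ∃ c : Fin m, Pc W c a) ∧
    (∀ a : Fin n, ∀ cc' : Fin m × Fin m, Pc W cc'.1 a → Pc W cc'.2 a → cc'.1 = cc'.2) ∧
      ∀ s : Fin ar.length, ∀ x : Fin (ar.get s) → Fin n, R s x = true →
        ∃ y : Fin (ar.get s) → Fin m, T s y = true ∧ ∀ i, Pc W (y i) (x i)

/-- The witness atom is definable. [folklore] -/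
theorem isDef_Pc {α : Type} (c : Fin m) (x : α) :
    JQuery.IsDef (fun _ (_ : RelTables ar _) (W : RelTables (cspWit m) _) (v : α → _) =>
      Pc W c (v x)) :=
  (JQuery.isDef_witRel (ar := ar) (wsym c) (fun _ => x)).of_iff fun _ _ _ _ => Iff.rfl

/-- **The query is first-order.** [cite: Libkin2004, Thm. 9.6 (proof, first part)] -/
theorem isDef_cspQuery (T : RelTables ar m) : (cspQuery T).IsDef := by
  -- every element has a colour
  have h1 : JQuery.IsDef (fun n (_ : RelTables ar n) (W : RelTables (cspWit m) n) (_ : Empty → Fin n) =>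
      ∀ a : Fin n, ∃ c : Fin m, Pc W c a) := by
    refine (JQuery.IsDef.iSup (ι := Fin m) fun c => isDef_Pc (α := Empty ⊕ Unit) (ar := ar) c
      (Sum.inr ())).all.of_iff fun n R W v => ?_
    simp only [Sum.elim_inr]
  -- at most one colour
  have h2 : JQuery.IsDef (fun n (_ : RelTables ar n) (W : RelTables (cspWit m) n) (_ : Empty → Fin n) =>
      ∀ a : Fin n, ∀ cc' : Fin m × Fin m, Pc W cc'.1 a → Pc W cc'.2 a → cc'.1 = cc'.2) := by
    refine (JQuery.IsDef.iInf (ι := Fin m × Fin m) fun cc' =>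
      (isDef_Pc (α := Empty ⊕ Unit) (ar := ar) cc'.1 (Sum.inr ())).imp
        ((isDef_Pc (α := Empty ⊕ Unit) (ar := ar) cc'.2 (Sum.inr ())).imp
          (JQuery.isDef_const (cc'.1 = cc'.2)))).all.of_iff fun n R W v => ?_
    simp only [Sum.elim_inr]
  -- every input tuple goes into the template
  have h3 : ∀ s : Fin ar.length, JQuery.IsDef (fun n (R : RelTables ar n) (W : RelTables (cspWit m) n)
      (_ : Empty → Fin n) => ∀ x : Fin (ar.get s) → Fin n, R s x = true →
        ∃ y : Fin (ar.get s) → Fin m, T s y = true ∧ ∀ i, Pc W (y i) (x i)) := by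
    intro s
    refine ((JQuery.isDef_inRel (wit := cspWit m) s
      (Sum.inr : Fin (ar.get s) → Empty ⊕ Fin (ar.get s))).imp
      (JQuery.IsDef.iSup (ι := Fin (ar.get s) → Fin m) fun y =>
        (JQuery.isDef_const (T s y = true)).and
          (JQuery.IsDef.iInf (ι := Fin (ar.get s)) fun i =>
            isDef_Pc (ar := ar) (y i) (Sum.inr i)))).alls.of_iff fun n R W v => ?_
    rfl
  exact (h1.and (h2.and (JQuery.IsDef.iInf h3))).of_iff fun n R W v => Iff.rfl

/-- **Semantics**: the query with guessed witnesses holds iff the instance maps homomorphically to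
the template. [cite: Libkin2004, Thm. 9.6 (proof, first part)] -/
theorem exists_cspQuery_iff (T : RelTables ar m) (n : ℕ) (R : RelTables ar n) :
    (∃ W : RelTables (cspWit m) n, cspQuery T R W Empty.elim) ↔ HasHomTo R T := by
  rw [hasHomTo_iff]
  constructor
  · rintro ⟨W, hall, huniq, htup⟩
    choose f hf using hall
    refine ⟨f, fun s x hx => ?_⟩
    obtain ⟨y, hy, hyx⟩ := htup s x hx
    have : y = f ∘ x := funext fun i => huniq (x i) (y i, f (x i)) (hyx i) (hf (x i))
    rwa [this] at hy
  · rintro ⟨f, hf⟩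
    refine ⟨fun s w => decide (f (w ⟨0, by simp⟩) = colourOf s), fun a => ⟨f a, ?_⟩,
      fun a cc' h1 h2 => ?_, fun s x hx => ⟨f ∘ x, hf s x hx, fun i => ?_⟩⟩
    · simp [Pc]
    · simp only [Pc, colourOf_wsym, decide_eq_true_eq] at h1 h2
      rw [← h1, ← h2]
    · simp [Pc]

/-- `CSP(T)` is the class cut out by the query. [folklore] -/
theorem classOf_cspQuery (T : RelTables ar m) : classOf (cspQuery T) = cspClass T :=
  Set.ext fun ⟨n, R⟩ => by rw [mem_classOf_iff, exists_cspQuery_iff, mem_cspClass_iff]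

end CSPInNP

/-- **`CSP(T) ∈ NP` for every finite template over a non-degenerate vocabulary** (Fagin's easy
direction applied to the `∃SO` sentence "guess the colouring, check the tuples").
[cite: Libkin2004, Thm. 9.6 (proof, first part, p. 170)] -/
theorem cspLanguage_mem_NP {ar : List ℕ} {m : ℕ} (T : RelTables ar m) (har : IsNondegenerateVocab ar) :
    cspLanguage T ∈ Nondeterministic.NP := by
  obtain ⟨Φ, hΦ⟩ := IsESODefinable.of_isDef_iff (CSPInNP.isDef_cspQuery T)
    (C := cspClass T) fun n R => by
      rw [CSPInNP.exists_cspQuery_iff, mem_cspClass_iff]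
  have h := eso_subset_NP_holds ar har Φ
  have hl : Φ.language = cspLanguage T := by rw [ESOSentence.language, hΦ]; rfl
  rwa [hl] at h

end Literature.ModelTheory.FiniteModelTheory
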